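import Summits.Ventures.Crystal3D.Bulk.SphereCodeCut
import Literature.Geometry.DiscreteGeometry.KissingArccosBrackets
import HarnessLib

/-!
# The sprint's TOP CUT in the kernel: `T13(arccos (1299/2500))` ⇒ `NoHole 0.559` (ρ* < 56.0134°)

HONEST FRAMING. Part of the venture `Summits/Ventures/Crystal3D` (cell `pub-crystal3d`, phase 2,
24-hour decision sprint; seat typer-bulk; the lead's rulings 2026-08-22T20:10:17Z / 20:11:00Z:
"the SphereCodeBoundInner 1299/2500 instance is the one that matters"). p2's exact SDP certificate
of record (`T13(58.694576°)`, Bachoc–Vallentin-type, verified in exact rational arithmetic OUTSIDE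
Lean, kit j171646 and successors; second verifier + referee replay per the lead) states LITERALLY
`SphereCodeBoundInner (1299/2500)`: no thirteen unit vectors of `ℝ³` have all pairwise inner
products `≤ 1299/2500`. This file turns it — AS A HYPOTHESIS, nothing is asserted — into a kernel
cut through the PROVED exchange rate (`Bulk/SphereCodeCut.lean`, `Bulk/PolarContraction.lean`)
with the rational contraction factor `λ = 9783/10000` and the rational radius `ρ₀ = 391/400` rad
(`= 0.9775 = 56.0066°`):

* the three numeric facts, by the tree's PROVED polynomial cosine brackets
  (`KissingLP.cosLoQ_le_cos`, `KissingLP.cos_le_cosHiQ`, valid on `[0, 2.6]`) evaluated in `ℚ` by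
  `norm_num`, and Mathlib's `π` enclosures `pi_gt_d6`/`pi_lt_d6`:
  `cos (λπ/3) ≤ 1299/2500` (pair condition: `λ·60° = 58.698° ≥ θ₁ = 58.694576°`),
  `−1299/2500 ≤ cos (λ(π − ρ₀))` (pole condition, through `cos x = −cos (π − x)` so that the
  bracket is used near `1.02 rad` where it is sharp), `0.559 ≤ cos ρ₀` — each an EXACT rational
  comparison against a proved bracket, margins `1.8·10⁻⁵ / 7.9·10⁻⁶ / 9·10⁻⁵`;
* `noHole_0559_of_sphereCodeBoundInner : SphereCodeBoundInner (1299/2500) → NoHole 0.559`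
  (`arccos 0.559 = 56.0133…°`: the extremal hole radius is `< 56.0134°`);
* the composition with the window census (`Bulk/GapWindow.lean`):
  `noHole_063_of_topCut_of_window : SphereCodeBoundInner (1299/2500) →
     ExtremalFreeWindow 1.118 1.26 → NoHole 0.63` — i.e. the exact top cut plus a census clearing
  the hole radii `[50.949877°, 56.0134°]` (intruder distances `[1.118, 1.26]`, cosine cells down
  to `t = 0.559`) give GAP(1.26), and then `BulkCrystallization3D 1296 / 702` given the tree's
  classification (`…_of_classification`).

The optimal exchange rate would allow `ρ₀ = ρ_cut(58.694576°) = 55.99663°`; the `0.017°` given away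
here is the price of rational `λ, ρ₀, t` and of the quarter-angle brackets' precision (a sharper
instance needs only sharper cosine enclosures). Standard axioms only.
-/

noncomputable section

open Real

namespace Summit.Ventures.Crystal3D

open Literature.Geometry.DiscreteGeometry Literature.Geometry.DiscreteGeometry.KissingLP

namespace TopCut

/-- The contraction factor `λ = 9783/10000`. -/
def lam : ℝ := 9783 / 10000

/-- The cut radius `ρ₀ = 391/400 = 0.9775 rad = 56.0066…°`. -/
def rho0 : ℝ := 391 / 400

/-- `0 ≤ λ`. -/
theorem lam_nonneg : 0 ≤ lam := by unfold lam; norm_num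

/-- `λ ≤ 1`. -/
theorem lam_le_one : lam ≤ 1 := by unfold lam; norm_num

/-- `0 < ρ₀`. -/
theorem rho0_pos : 0 < rho0 := by unfold rho0; norm_num

/-- `ρ₀ ≤ π`. -/
theorem rho0_le_pi : rho0 ≤ π := by unfold rho0; linarith [pi_gt_three]

/-- **Pair condition**: `cos (λ·π/3) ≤ 1299/2500` (`λ·60° = 58.698° ≥ θ₁ = 58.694576°`). Proof:
`λπ/3 ≥ x_lo := λ·3.141592/3` (Mathlib's `pi_gt_d6`), `cos` is antitone on `[0, π]`, and
`cos x_lo ≤ cosHiQ x_lo ≤ 1299/2500` (the tree's upper bracket, evaluated in `ℚ`). -/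
theorem cos_pair_le : cos (lam * (π / 3)) ≤ 1299 / 2500 := by
  have hpi := pi_gt_d6
  have hpi' := pi_lt_d6
  set q : ℚ := 9783 / 10000 * (3141592 / 1000000) / 3 with hq
  have hqR : ((q : ℚ) : ℝ) = 9783 / 10000 * (3.141592 : ℝ) / 3 := by rw [hq]; push_cast; ring
  have hx : ((q : ℚ) : ℝ) ≤ lam * (π / 3) := by rw [hqR]; unfold lam; nlinarith
  have hxπ : lam * (π / 3) ≤ π := by unfold lam; nlinarith
  have h1 : cos (lam * (π / 3)) ≤ cos ((q : ℚ) : ℝ) :=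
    cos_le_cos_of_nonneg_of_le_pi (by rw [hqR]; norm_num) hxπ hx
  have h2 : cos ((q : ℚ) : ℝ) ≤ ((cosHiQ q : ℚ) : ℝ) :=
    cos_le_cosHiQ (by rw [hq]; norm_num) (by rw [hq]; norm_num)
  have h3 : ((cosHiQ q : ℚ) : ℝ) ≤ 1299 / 2500 := by
    have : cosHiQ q ≤ 1299 / 2500 := by rw [hq]; norm_num [cosHiQ]
    calc ((cosHiQ q : ℚ) : ℝ) ≤ ((1299 / 2500 : ℚ) : ℝ) := by exact_mod_cast this
      _ = 1299 / 2500 := by norm_num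
  exact h1.trans (h2.trans h3)

/-- **Pole condition**: `−1299/2500 ≤ cos (λ(π − ρ₀))` (`λ(180° − 56.0066°) = 121.303° ≤
180° − θ₁ = 121.305°`). Proof: `cos (λ(π − ρ₀)) = −cos z` with `z = π − λ(π − ρ₀) = (1 − λ)π + λρ₀`
(`cos_pi_sub`), `z ≥ z_lo := (1 − λ)·3.141592 + λρ₀` (`pi_gt_d6`), `cos` antitone on `[0, π]`,
and `cos z_lo ≤ cosHiQ z_lo ≤ 1299/2500` (the bracket is used at `z_lo ≈ 1.0245`, where it is
sharp, rather than at `λ(π − ρ₀) ≈ 2.117`). -/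
theorem neg_le_cos_pole : -(1299 / 2500 : ℝ) ≤ cos (lam * (π - rho0)) := by
  have hpi := pi_gt_d6
  have hpi' := pi_lt_d6
  set q : ℚ := (1 - 9783 / 10000) * (3141592 / 1000000) + 9783 / 10000 * (391 / 400) with hq
  have hqR : ((q : ℚ) : ℝ) = (1 - 9783 / 10000) * (3.141592 : ℝ) + 9783 / 10000 * (391 / 400) := by
    rw [hq]; push_cast; ring
  have hz : lam * (π - rho0) = π - (π - lam * (π - rho0)) := by ring
  rw [hz, cos_pi_sub, neg_le_neg_iff]
  have hx : ((q : ℚ) : ℝ) ≤ π - lam * (π - rho0) := by rw [hqR]; unfold lam rho0; nlinarith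
  have hq0 : 0 ≤ ((q : ℚ) : ℝ) := by rw [hqR]; norm_num
  have hxπ : π - lam * (π - rho0) ≤ π := by unfold lam rho0; nlinarith
  have h1 : cos (π - lam * (π - rho0)) ≤ cos ((q : ℚ) : ℝ) :=
    cos_le_cos_of_nonneg_of_le_pi hq0 hxπ hx
  have h2 : cos ((q : ℚ) : ℝ) ≤ ((cosHiQ q : ℚ) : ℝ) :=
    cos_le_cosHiQ (by rw [hq]; norm_num) (by rw [hq]; norm_num)
  have h3 : ((cosHiQ q : ℚ) : ℝ) ≤ 1299 / 2500 := by
    have : cosHiQ q ≤ 1299 / 2500 := by rw [hq]; norm_num [cosHiQ]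
    calc ((cosHiQ q : ℚ) : ℝ) ≤ ((1299 / 2500 : ℚ) : ℝ) := by exact_mod_cast this
      _ = 1299 / 2500 := by norm_num
  exact h1.trans (h2.trans h3)

/-- **The cut level**: `0.559 ≤ cos ρ₀` (`cos 0.9775 = 0.559097…`). -/
theorem t_le_cos_rho0 : (0.559 : ℝ) ≤ cos rho0 := by
  have h2 : ((cosLoQ (391 / 400) : ℚ) : ℝ) ≤ cos (((391 / 400 : ℚ) : ℚ) : ℝ) :=
    cosLoQ_le_cos (by norm_num) (by norm_num)
  have h3 : (0.559 : ℝ) ≤ ((cosLoQ (391 / 400) : ℚ) : ℝ) := by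
    have : (559 / 1000 : ℚ) ≤ cosLoQ (391 / 400) := by norm_num [cosLoQ]
    have h' : ((559 / 1000 : ℚ) : ℝ) ≤ ((cosLoQ (391 / 400) : ℚ) : ℝ) := by exact_mod_cast this
    have e : ((559 / 1000 : ℚ) : ℝ) = 0.559 := by norm_num
    rwa [e] at h'
  have e2 : (((391 / 400 : ℚ) : ℚ) : ℝ) = rho0 := by unfold rho0; norm_num
  rw [e2] at h2
  exact h3.trans h2

end TopCut

open TopCut

/-- **THE SPRINT'S TOP CUT IN THE KERNEL.** If no thirteen unit vectors of `ℝ³` have all pairwise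
inner products `≤ 1299/2500` (p2's exact SDP certificate `T13(58.694576°)`, a HYPOTHESIS here),
then `NoHole 0.559`: every shell of twelve `60°`-separated directions has a direction within
angle `< arccos 0.559 = 56.0133…°` of every `p` — the extremal hole radius satisfies
`ρ* < 56.0134°`. Exchange rate `λ = 9783/10000` about the antipode (PROVED polar contraction), no
paper lemma, standard axioms. -/
theorem noHole_0559_of_sphereCodeBoundInner (hT : SphereCodeBoundInner (1299 / 2500)) :
    NoHole 0.559 :=
  noHole_of_sphereCodeBoundInner lam_nonneg lam_le_one rho0_pos.le rho0_le_pi t_le_cos_rho0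
    (by norm_num) (by norm_num) cos_pair_le neg_le_cos_pole hT

/-- **TOP CUT + WINDOW ⇒ GAP(1.26)**: p2's certificate plus a census clearing the intruder
distances `[1.118, 1.26]` (hole radii `[50.949877°, 56.0134°]`, cosine cells down to `t = 0.559`)
give `NoHole 0.63` — the UNCONDITIONAL route of `DECISION-GAP` §2.U in kernel form (modulo the two
certified computations named in the hypotheses). -/
theorem noHole_063_of_topCut_of_window (hT : SphereCodeBoundInner (1299 / 2500))
    (hwin : ExtremalFreeWindow 1.118 1.26) : NoHole 0.63 :=
  noHole_063_of_noHole_of_window (noHole_0559_of_sphereCodeBoundInner hT)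
    (by rw [show (2 : ℝ) * 0.559 = 1.118 by norm_num]; exact hwin)

/-- The same with the census in schema form (`GapCensus.CompleteReducedOn`, `GapCensus.AllKilled`
of `Bulk/GapWindow.lean` / `Bulk/GapCensusSkeleton.lean`). -/
theorem noHole_063_of_topCut_of_census (hT : SphereCodeBoundInner (1299 / 2500)) (S : GapCensus)
    (hC : S.CompleteReducedOn 1.118 1.26) (hK : S.AllKilled) : NoHole 0.63 :=
  noHole_063_of_topCut_of_window hT (S.extremalFreeWindow hC hK)

/-- **… ⇒ bulk crystallization, `K = 1296`**, given the classification of kissing configurations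
at gap `2.52` (`Hales2012_kissingConfigCongruent`, the tree's computational theorem; a hypothesis
here). -/
theorem bulkCrystallization3D_of_topCut_of_window_of_classification
    (hT : SphereCodeBoundInner (1299 / 2500)) (hwin : ExtremalFreeWindow 1.118 1.26)
    (hcl : Hales2012_kissingConfigCongruent) : BulkCrystallization3D 1296 :=
  bulkCrystallization3D_of_noHole_of_classification (noHole_063_of_topCut_of_window hT hwin) hcl

/-- **… with `K = 702`.** -/
theorem bulkCrystallization3D_sharp_of_topCut_of_window_of_classification
    (hT : SphereCodeBoundInner (1299 / 2500)) (hwin : ExtremalFreeWindow 1.118 1.26)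
    (hcl : Hales2012_kissingConfigCongruent) : BulkCrystallization3D 702 :=
  bulkCrystallization3D_sharp_of_noHole_of_window_of_classification
    (noHole_0559_of_sphereCodeBoundInner hT)
    (by rw [show (2 : ℝ) * 0.559 = 1.118 by norm_num]; exact hwin) hcl

end Summit.Ventures.Crystal3D

end
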